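/-
Copyright (c) 2026 the pub-hodgecm-mathlib formalisation cell (harness21).  Prover seat hodgecm-mathlib-K2Liu-p11 (g2), Track B «K2-LIT»,
#184♮ = hLiu418 = `stmt-HodgeConjecture-24832`; Road Φ ∕ U1-CT-ind stage 3, face (β0-hol) (LEAD F0P6-plan (g14) BATCH #6 (7) + RULING «M-158f»:
«(β0-hol) RE-DEALT → K2Liu-p11»; consumer K2Liu-p14 (g2) ★ (β0-3) `exists_flat_coords` ∕ ★ (β0-4) `exists_middle_finite_sum`, binder `hφhol`).
THEOREMS ONLY (no `def`, no `instance`, no notation, no named-fact hypothesis, no `sorry`).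
-/
import Summits.HodgeConjecture.HodgeConjecture.Theorems.K2LiuContinuedFamilyUnipotentIntegralsHolomorphic  -- ★ W3-a: compact-weight case on `N_Δ(𝔸)`, `HA` currency
import Literature.Analysis.Complex.HolomorphicParametricIntegral                                           -- ★ `differentiableOn_integral_of_dominated`
import HarnessLib

/-!
# Crux `HLiu418`, Road Φ, face (β0-hol): THE INNER SECTION `s ↦ F_s(y) = ∫ β₁(u) • f_s(w₀ u y) dν(u)` OF THE MIDDLE CELL IS HOLOMORPHIC IN `s`
# — dominated holomorphy, hypothesis-first (the majorant BY VALUE), and the `φ`-level binder `hφhol` of ★ (β0-3)∕(β0-4) VERBATIM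

Cell `hodgecm-mathlib`, crux item hLiu418 = `stmt-HodgeConjecture-24832` (helper lane `--supports`, count-neutral).

The (β0) consumption chain (★ `K2LiuMiddleInnerSectionFlatCoords.exists_flat_coords`, ★ `K2LiuMiddleCellPackageOfFaces.exists_middle_finite_sum ∕
exists_middle_package_of_faces`) takes BY VALUE `hφhol : ∀ x k, DifferentiableOn ℂ (fun s => φ s x k) {s | 0 < s.re}` for the untwisted family
`φ s x g = ξ(det g)⁻¹ · ξ(det m_x) · F s (Λ g · k_x)` built on the INNER SECTION of ★ α3-2 `K2LiuConstantTermMiddleCellGL2`,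
`F s y = ∫ u, (β₁ u).toReal • f s (w₀ * (u * y)) ∂νN` (`β₁` a `Γ₀`-covering weight on `N_Δ(𝔸)`), unfolded by (β0-1a) to `c · ∫ t, f s (w₀ * n₂ t * y) ∂μ`.
This file pays `hφhol` from the holomorphy of the SECTION FAMILY `f` by dominated holomorphy (★ `Literature.Analysis.Complex.differentiableOn_integral_of_dominated`:
Cauchy estimates under the integral — no formula, measurability or bound for `∂_s f` is needed):
* §1 GENERIC **`differentiableOn_integral_toReal_smul_family`** — `s ↦ ∫ (β u).toReal • f s (a u) dν` is `DifferentiableOn ℂ U` as soon as `u ↦ f s (a u)` is a.e.-strongly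
  measurable (`s ∈ U`), `s ↦ f s (a u)` is holomorphic on `U` for every `u`, and every `z ∈ U` has a ball on which `(β u).toReal · ‖f s (a u)‖ ≤ g(u)` with `g ∈ L¹(ν)`
  (the MAJORANT `hdom`, BY VALUE: for the flat standard family it is the rank-one intertwining decay `‖f_s(w₀ n₂(t) y)‖ ≤ C_y ∏_v max(1,|t|_v)^{−2(re s + 1)}`, (δ)∕#41 capital);
  `differentiableOn_const_mul_integral_family` (an outer constant, (β0-1a)'s `c`);
* §2 THE CONSUMERS' SHAPES: `differentiableOn_innerSection` (α3-2's `F` on `H(𝔸)`, `a u = w₀ * (u * y)`), `differentiableOn_innerSection_of_isCompact` (the compactly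
  supported weight case, NO majorant hypothesis: ★ W3-a `differentiableOn_integral_wt_mul_family` at `c := 1` from (A1)(A2)(A5) of the family), and
  `differentiableOn_unfolded` ((β0-1a)'s `c · ∫ t, f s (w₀ * n₂ t * y) ∂μ`);
* §3 **`differentiableOn_phi`** — from `∀ y, DifferentiableOn ℂ (fun s => F s y) U` to `∀ x g, DifferentiableOn ℂ (fun s => φ s x g) U` for every `φ` of the shape
  `φ s x g = c g x · F s (Λ g · k x)` — the binder `hφhol` VERBATIM (`U = {0 < re}`).
References: [Conway1978, IV §2 (Leibniz rule: holomorphy of parameter integrals)]; [MoeglinWaldspurger1995, II.1.7, IV.1.9]; [KudlaRallis1994, §1–§2].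
HONEST LABEL: HC_CM is proved only modulo the 7 printed citations (2 remaining named inputs: hLiu418 = stmt-HodgeConjecture-24832,
h413 = stmt-HodgeConjecture-24833) until rung 0 closes; count-neutral helper, closes no socket.
-/

set_option autoImplicit false
set_option linter.dupNamespace false

noncomputable section

open MeasureTheory Metric Set Filter
open scoped ENNReal NNReal Topology

namespace Summit.HodgeConjecture.HodgeConjecture.Cruxes.HLiu418.K2LiuMiddleInnerSectionHolomorphic

/-! ## §1  Generic dominated holomorphy of `s ↦ ∫ (β u).toReal • f s (a u) dν` -/

section Generic

variable {X : Type*} [MeasurableSpace X] {H : Type*}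

/-- **DOMINATED HOLOMORPHY OF A WEIGHTED SLICE INTEGRAL.**  `s ↦ ∫ (β u).toReal • f s (a u) dν` is holomorphic on the open `U` if the integrand is a.e.-strongly
measurable for `s ∈ U`, holomorphic in `s` for every `u`, and locally (in `s`) dominated by an integrable `g`.  The majorant is the only analytic input and is
taken BY VALUE. [Conway1978, IV §2] [MoeglinWaldspurger1995, IV.1.9] -/
theorem differentiableOn_integral_toReal_smul_family (ν : Measure X) {U : Set ℂ} (f : ℂ → H → ℂ) (a : X → H) (β : X → ℝ≥0∞)
    (hβm : Measurable β) (hmeas : ∀ s ∈ U, AEStronglyMeasurable (fun u => f s (a u)) ν) (hfd : ∀ u, DifferentiableOn ℂ (fun s => f s (a u)) U)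
    (hdom : ∀ z ∈ U, ∃ R > (0 : ℝ), ball z R ⊆ U ∧ ∃ g : X → ℝ, Integrable g ν ∧ ∀ u, ∀ s ∈ ball z R, (β u).toReal * ‖f s (a u)‖ ≤ g u) :
    DifferentiableOn ℂ (fun s => ∫ u, (β u).toReal • f s (a u) ∂ν) U := by
  refine Literature.Analysis.Complex.differentiableOn_integral_of_dominated (F := fun s u => (β u).toReal • f s (a u)) (U := U) ?_ ?_ ?_
  · intro s hs
    exact (hβm.ennreal_toReal.aestronglyMeasurable).smul (hmeas s hs)
  · exact Eventually.of_forall fun u => (differentiableOn_const ((β u).toReal : ℂ)).smul (hfd u)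
  · intro z hz
    obtain ⟨R, hR, hRU, g, hg, hgb⟩ := hdom z hz
    refine ⟨R, hR, hRU, g, hg, Eventually.of_forall fun u s hs => ?_⟩
    rw [norm_smul, Real.norm_of_nonneg ENNReal.toReal_nonneg]
    exact hgb u s hs

/-- The same with an outer constant ((β0-1a)'s `c`, or the normalisation of a covering weight). [Conway1978, IV §2] -/
theorem differentiableOn_const_mul_integral_family (ν : Measure X) {U : Set ℂ} (f : ℂ → H → ℂ) (a : X → H) (β : X → ℝ≥0∞)
    (hβm : Measurable β) (hmeas : ∀ s ∈ U, AEStronglyMeasurable (fun u => f s (a u)) ν) (hfd : ∀ u, DifferentiableOn ℂ (fun s => f s (a u)) U)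
    (hdom : ∀ z ∈ U, ∃ R > (0 : ℝ), ball z R ⊆ U ∧ ∃ g : X → ℝ, Integrable g ν ∧ ∀ u, ∀ s ∈ ball z R, (β u).toReal * ‖f s (a u)‖ ≤ g u) (c : ℂ) :
    DifferentiableOn ℂ (fun s => c * ∫ u, (β u).toReal • f s (a u) ∂ν) U :=
  (differentiableOn_const c).mul (differentiableOn_integral_toReal_smul_family ν f a β hβm hmeas hfd hdom)

/-- **UNWEIGHTED FORM** (`β = 1`, (β0-1a)'s unfolded integral over the corner line): `s ↦ ∫ f s (a t) dμ` is holomorphic on `U` under a.e.-measurability,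
pointwise holomorphy and a local integrable majorant of `‖f s (a t)‖`. [Conway1978, IV §2] -/
theorem differentiableOn_integral_family (ν : Measure X) {U : Set ℂ} (f : ℂ → H → ℂ) (a : X → H)
    (hmeas : ∀ s ∈ U, AEStronglyMeasurable (fun u => f s (a u)) ν) (hfd : ∀ u, DifferentiableOn ℂ (fun s => f s (a u)) U)
    (hdom : ∀ z ∈ U, ∃ R > (0 : ℝ), ball z R ⊆ U ∧ ∃ g : X → ℝ, Integrable g ν ∧ ∀ u, ∀ s ∈ ball z R, ‖f s (a u)‖ ≤ g u) :
    DifferentiableOn ℂ (fun s => ∫ u, f s (a u) ∂ν) U := by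
  refine Literature.Analysis.Complex.differentiableOn_integral_of_dominated (F := fun s u => f s (a u)) (U := U) hmeas
    (Eventually.of_forall fun u => hfd u) fun z hz => ?_
  obtain ⟨R, hR, hRU, g, hg, hgb⟩ := hdom z hz
  exact ⟨R, hR, hRU, g, hg, Eventually.of_forall fun u s hs => hgb u s hs⟩

end Generic

/-! ## §2  The consumers' shapes -/

section Unfolded

variable {T : Type*} [MeasurableSpace T] {H : Type*} [Mul H]

/-- **(β0-1a)'s UNFOLDED INNER SECTION IS HOLOMORPHIC**: `s ↦ c · ∫ t, f s (w₀ * n₂ t * y) ∂μ` is `DifferentiableOn ℂ U` under a.e.-measurability, pointwise holomorphy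
of the section family along the corner line, and a local integrable majorant on it (BY VALUE). [MoeglinWaldspurger1995, II.1.7] [Conway1978, IV §2] -/
theorem differentiableOn_unfolded (μ : Measure T) {U : Set ℂ} (f : ℂ → H → ℂ) (w₀ y : H) (n₂ : T → H) (c : ℂ)
    (hmeas : ∀ s ∈ U, AEStronglyMeasurable (fun t => f s (w₀ * n₂ t * y)) μ) (hfd : ∀ t, DifferentiableOn ℂ (fun s => f s (w₀ * n₂ t * y)) U)
    (hdom : ∀ z ∈ U, ∃ R > (0 : ℝ), ball z R ⊆ U ∧ ∃ g : T → ℝ, Integrable g μ ∧ ∀ t, ∀ s ∈ ball z R, ‖f s (w₀ * n₂ t * y)‖ ≤ g t) :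
    DifferentiableOn ℂ (fun s => c * ∫ t, f s (w₀ * n₂ t * y) ∂μ) U :=
  (differentiableOn_const c).mul (differentiableOn_integral_family μ f (fun t => w₀ * n₂ t * y) hmeas hfd hdom)

end Unfolded

section Adelic

open NumberField IsDedekindDomain
open Literature.NumberTheory.Automorphic Literature.NumberTheory.Automorphic.UnitaryGroup
open Literature.NumberTheory.GelbartRogawski1991 Literature.NumberTheory.GelbartRogawski1991.GRConstruction
open Literature.NumberTheory.K2Lit.SiegelDoubled
open Summit.HodgeConjecture.HodgeConjecture.Cruxes.HLiu418.K2LiuContinuedFamilyUnipotentIntegralsHolomorphic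

variable (L : Type) [Field L] [NumberField L] [IsCMField L]
variable {N M n : ℕ} (e : Fin N × Fin M ≃ Fin n)
  (dV : Fin N → L) (hdV : ∀ i, IsCMField.complexConj L (dV i) = dV i)
  (dW : Fin M → L) (hdW : ∀ i, IsCMField.complexConj L (dW i) = dW i)
variable [MeasurableSpace (unipDelta L e dV hdV dW hdW)] [BorelSpace (unipDelta L e dV hdV dW hdW)]

omit [BorelSpace (unipDelta L e dV hdV dW hdW)] in
/-- **α3-2's INNER SECTION IS HOLOMORPHIC (majorant by value)**: for `F s y = ∫ u, (β₁ u).toReal • f s (w₀ * (u * y)) ∂νN` on `H(𝔸) = U(𝕍 ⊕ −𝕍)(𝔸)` with `β₁` measurable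
(e.g. a covering weight, ★ `IsCoveringWeight.measurable`), the section family `f` a.e.-measurable along the slice, holomorphic in `s` pointwise, and locally dominated:
`s ↦ F s y` is `DifferentiableOn ℂ U`. [MoeglinWaldspurger1995, II.1.7, IV.1.9] [Conway1978, IV §2] -/
theorem differentiableOn_innerSection (νN : Measure (unipDelta L e dV hdV dW hdW)) {U : Set ℂ} (f : ℂ → HA L e dV hdV dW hdW → ℂ)
    (w₀ y : HA L e dV hdV dW hdW) {β₁ : unipDelta L e dV hdV dW hdW → ℝ≥0∞} (hβm : Measurable β₁)
    (hmeas : ∀ s ∈ U, AEStronglyMeasurable (fun u : unipDelta L e dV hdV dW hdW => f s (w₀ * ((u : HA L e dV hdV dW hdW) * y))) νN)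
    (hfd : ∀ u : unipDelta L e dV hdV dW hdW, DifferentiableOn ℂ (fun s => f s (w₀ * ((u : HA L e dV hdV dW hdW) * y))) U)
    (hdom : ∀ z ∈ U, ∃ R > (0 : ℝ), ball z R ⊆ U ∧ ∃ g : unipDelta L e dV hdV dW hdW → ℝ, Integrable g νN ∧
      ∀ u, ∀ s ∈ ball z R, (β₁ u).toReal * ‖f s (w₀ * ((u : HA L e dV hdV dW hdW) * y))‖ ≤ g u)
    (F : ℂ → HA L e dV hdV dW hdW → ℂ) (hF : ∀ s, F s y = ∫ u, (β₁ u).toReal • f s (w₀ * ((u : HA L e dV hdV dW hdW) * y)) ∂νN) :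
    DifferentiableOn ℂ (fun s => F s y) U := by
  have h := differentiableOn_integral_toReal_smul_family νN f (fun u : unipDelta L e dV hdV dW hdW => w₀ * ((u : HA L e dV hdV dW hdW) * y)) β₁
    hβm hmeas hfd hdom
  refine h.congr fun s _ => ?_
  exact hF s

/-- **COMPACTLY SUPPORTED WEIGHT — NO MAJORANT HYPOTHESIS**: if `β₁` has finite mass and vanishes off a compact `K ⊆ N_Δ(𝔸)` and the family `f` has (A1) holomorphy on
the open `U`, (A2) continuity, (A5) locally uniform height growth, then `s ↦ F s y` is holomorphic on `U` (★ W3-a `differentiableOn_integral_wt_mul_family` at `c := 1`;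
`0 < n`). [MoeglinWaldspurger1995, IV.1.9] -/
theorem differentiableOn_innerSection_of_isCompact (hn : 0 < n) (νN : Measure (unipDelta L e dV hdV dW hdW)) {U : Set ℂ} (hU : IsOpen U)
    (f : ℂ → HA L e dV hdV dW hdW → ℂ) (w₀ y : HA L e dV hdV dW hdW) {β₁ : unipDelta L e dV hdV dW hdW → ℝ≥0∞} (hβm : Measurable β₁)
    (hβtop : ∫⁻ u, β₁ u ∂νN ≠ ∞) {K : Set (unipDelta L e dV hdV dW hdW)} (hK : IsCompact K) (hβK : ∀ u, β₁ u ≠ 0 → u ∈ K)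
    (hfd : ∀ h, DifferentiableOn ℂ (fun s => f s h) U) (hfc : ∀ s ∈ U, Continuous (f s))
    (hgrowth : ∀ z ∈ U, ∃ C A r : ℝ, 0 < r ∧ ∀ s : ℂ, dist s z < r → ∀ h : HA L e dV hdV dW hdW,
      ‖f s h‖ ≤ C * adelicHeightGL (n + n) L (h : GL (Fin (n + n)) (AdeleRing (𝓞 L) L)) ^ A)
    (F : ℂ → HA L e dV hdV dW hdW → ℂ) (hF : ∀ s, F s y = ∫ u, (β₁ u).toReal • f s (w₀ * ((u : HA L e dV hdV dW hdW) * y)) ∂νN) :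
    DifferentiableOn ℂ (fun s => F s y) U := by
  have h := differentiableOn_integral_wt_mul_family L e dV hdV dW hdW hn νN hβm hβtop hK hβK (c := fun _ => (1 : ℂ)) continuous_const
    (fun _ => by simp) hU f hfd hfc hgrowth w₀ y
  refine h.congr fun s _ => ?_
  rw [hF s]
  refine integral_congr_ae (Eventually.of_forall fun u => ?_)
  simp only [one_mul]

end Adelic

/-! ## §3  The `φ`-level binder `hφhol` of ★ (β0-3) ∕ (β0-4) -/

section Phi

variable {H G X : Type*} [Mul H]

/-- **`hφhol` FROM THE INNER SECTION.**  If `s ↦ F s y` is holomorphic on `U` for every `y`, then every family of the shape `φ s x g = c g x · F s (Λ g · k x)`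
(the untwisted family of ★ (β0-4) §1: `c g x = ξ(det g)⁻¹ · ξ(det m_x)`) has `s ↦ φ s x g` holomorphic on `U` for all `x`, `g` — the binder `hφhol` of
★ `exists_flat_coords` ∕ ★ `exists_middle_finite_sum` verbatim at `U = {s | 0 < s.re}`. [MoeglinWaldspurger1995, II.1.7] -/
theorem differentiableOn_phi {U : Set ℂ} (F : ℂ → H → ℂ) (hF : ∀ y : H, DifferentiableOn ℂ (fun s => F s y) U) (c : G → X → ℂ) (Λ : G → H)
    (k : X → H) (φ : ℂ → X → G → ℂ) (hφ : ∀ s x g, φ s x g = c g x * F s (Λ g * k x)) (x : X) (g : G) :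
    DifferentiableOn ℂ (fun s => φ s x g) U := by
  have h : (fun s => φ s x g) = fun s => c g x * F s (Λ g * k x) := funext fun s => hφ s x g
  rw [h]
  exact (differentiableOn_const (c g x)).mul (hF _)

/-- The same read on a subtype of `G` (the consumer quantifies over `k : ↥K₂`, the maximal compact). [MoeglinWaldspurger1995, II.1.7] -/
theorem differentiableOn_phi_subtype {U : Set ℂ} (F : ℂ → H → ℂ) (hF : ∀ y : H, DifferentiableOn ℂ (fun s => F s y) U) (c : G → X → ℂ) (Λ : G → H)
    (k : X → H) (φ : ℂ → X → G → ℂ) (hφ : ∀ s x g, φ s x g = c g x * F s (Λ g * k x)) {p : G → Prop} (x : X) (g : Subtype p) :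
    DifferentiableOn ℂ (fun s => φ s x (g : G)) U :=
  differentiableOn_phi F hF c Λ k φ hφ x (g : G)

/-- **TWO-CONSTANT SHAPE** (`φ s x g = a g · b x · F s (Λ g · k x)`, literally (β0-4) §1's `ξ(det g)⁻¹ · ξ(det m_x) · F s (Λ g * k_x)`). [MoeglinWaldspurger1995, II.1.7] -/
theorem differentiableOn_phi₂ {U : Set ℂ} (F : ℂ → H → ℂ) (hF : ∀ y : H, DifferentiableOn ℂ (fun s => F s y) U) (a : G → ℂ) (b : X → ℂ) (Λ : G → H)
    (k : X → H) (φ : ℂ → X → G → ℂ) (hφ : ∀ s x g, φ s x g = a g * b x * F s (Λ g * k x)) (x : X) (g : G) :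
    DifferentiableOn ℂ (fun s => φ s x g) U :=
  differentiableOn_phi F hF (fun g x => a g * b x) Λ k φ (fun s x g => by rw [hφ]) x g

end Phi

end Summit.HodgeConjecture.HodgeConjecture.Cruxes.HLiu418.K2LiuMiddleInnerSectionHolomorphic

end
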